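import Literature.NumberTheory.LFunctions.TaoLogElliottCircleMethod
import Literature.NumberTheory.LFunctions.RHWave0PNTProofs
import HarnessLib

/-!
# Tao's log-averaged Elliott theorem: the primes `𝒫_H` are numerous (from the prime number theorem)

Part of the proof DAG below the named fact `Literature.NumberTheory.LFunctions.Tao2016_theorem23_core` (Tao, Forum Math. Pi 4
(2016) e8, the proof of Theorem 2.3).  In Proposition 2.6 of the paper the set
`𝒫_H = {p prime : ε²H/2 ≤ p ≤ ε²H}` (`Literature.Tao2016.primesP ε H` of
`TaoLogElliottCircleMethod.lean`) enters through `∑_{p ∈ 𝒫_H} 1/p`, and the proof ends with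
"by the prime number theorem and the lower bound `|X| ≫ ε`, one has `… ≫ ε H/(a log H)`",
i.e. it uses **`∑_{p ∈ 𝒫_H} 1/p ≫ 1/log H`** (equivalently `#𝒫_H ≫ ε²H/log H`).  The matching
upper bounds (`#𝒫_H ≤ 3ε²H/log H`, `∑ 1/p ≤ 6/log H`) are `Literature.NumberTheory.LFunctions.Tao2016.card_primesP_le`, from
Chebyshev's bound; for the lower bound on a dyadic interval `[y/2, y]` Chebyshev's elementary
constants `log 2`/`log 4` exactly cancel, so we use the prime number theorem `ϑ(x) ~ x`, which
is PROVED in the tree (`Literature.NumberTheory.LFunctions.chebyshevTheta_isEquivalent`, from the Wiener–Ikehara route).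

* `card_primesP_ge` — for `0 < ε ≤ 1` and all large `H`: `#𝒫_H ≥ ε²H/(4 log H)` and
  `∑_{p ∈ 𝒫_H} 1/p ≥ 1/(4 log H)`.

## References
* T. Tao, Forum Math. Pi 4 (2016), e8; arXiv:1509.05422, §2, Proposition 2.6 (definition of
  `𝒫_H` and the last step of its proof, "by the prime number theorem").

## Design choices
* Stated `∀ᶠ H in atTop` for fixed `ε` (the paper: `H ≥ H₋` with `H₋` large depending on `ε`);
  constants `1/4` are not optimised (`ϑ(y) - ϑ(y/2) ≥ 0.35 y` once `|ϑ(x) - x| ≤ x/10`).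
-/

open Finset Real Filter Asymptotics

namespace Literature.NumberTheory.LFunctions

namespace Tao2016

/-- Primes `p` with `⌊y/2⌋ < p ≤ ⌊y⌋` contribute to `ϑ(y) - ϑ(y/2)`, and they all lie in
`𝒫 = {p : y/2 ≤ p ≤ y}`; hence `ϑ(y) - ϑ(y/2) ≤ #𝒫_H · log y` for `y = ε² H ≥ 1`. [folklore] -/
theorem theta_sub_theta_half_le {ε : ℝ} {H : ℕ} (hy : 1 ≤ ε ^ 2 * H) :
    Chebyshev.theta (ε ^ 2 * H) - Chebyshev.theta (ε ^ 2 * H / 2) ≤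
      (primesP ε H).card * Real.log (ε ^ 2 * H) := by
  set y : ℝ := ε ^ 2 * H with hy_def
  have hy0 : 0 ≤ y := by linarith
  rw [Chebyshev.theta_eq_sum_primesLE y, Chebyshev.theta_eq_sum_primesLE (y / 2)]
  have hsub : Nat.primesLE ⌊y / 2⌋₊ ⊆ Nat.primesLE ⌊y⌋₊ := by
    intro p hp
    rw [Nat.mem_primesLE] at hp ⊢
    exact ⟨hp.1.trans (Nat.floor_le_floor (by linarith)), hp.2⟩
  rw [← sum_sdiff hsub, add_sub_cancel_right]
  have hdiff : Nat.primesLE ⌊y⌋₊ \ Nat.primesLE ⌊y / 2⌋₊ ⊆ primesP ε H := by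
    intro p hp
    rw [Finset.mem_sdiff, Nat.mem_primesLE, Nat.mem_primesLE] at hp
    obtain ⟨⟨hpy, hpp⟩, hnot⟩ := hp
    have hgt : ⌊y / 2⌋₊ < p := lt_of_not_ge fun hle => hnot ⟨hle, hpp⟩
    rw [mem_primesP]
    refine ⟨hpp, ?_, ?_⟩
    · have : y / 2 < (⌊y / 2⌋₊ : ℝ) + 1 := Nat.lt_floor_add_one _
      have h' : ((⌊y / 2⌋₊ + 1 : ℕ) : ℝ) ≤ p := by exact_mod_cast hgt
      push_cast at h'
      rw [← hy_def]; linarith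
    · rw [← hy_def]
      exact le_trans (by exact_mod_cast hpy) (Nat.floor_le hy0)
  calc ∑ p ∈ Nat.primesLE ⌊y⌋₊ \ Nat.primesLE ⌊y / 2⌋₊, Real.log p
      ≤ ∑ p ∈ primesP ε H, Real.log p :=
        sum_le_sum_of_subset_of_nonneg hdiff fun p hp _ =>
          Real.log_nonneg (by exact_mod_cast (prime_of_mem_primesP hp).one_lt.le)
    _ ≤ ∑ p ∈ primesP ε H, Real.log y := by
        refine sum_le_sum fun p hp => Real.log_le_log ?_ (mem_primesP.1 hp).2.2
        exact_mod_cast (prime_of_mem_primesP hp).pos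
    _ = (primesP ε H).card * Real.log y := by rw [sum_const, nsmul_eq_mul]

/-- **`𝒫_H` is large, from the prime number theorem** (Tao 2016, end of the proof of
Proposition 2.6: "by the prime number theorem").  For `0 < ε ≤ 1` and all sufficiently large
`H`: `#𝒫_H ≥ ε² H / (4 log H)` and `∑_{p ∈ 𝒫_H} 1/p ≥ 1 / (4 log H)`.
[cite: TaoFMP2016, Proposition 2.6 (proof, last paragraph)] -/
theorem card_primesP_ge {ε : ℝ} (hε : 0 < ε) (hε1 : ε ≤ 1) :
    ∀ᶠ H : ℕ in atTop, ε ^ 2 * H / (4 * Real.log H) ≤ (primesP ε H).card ∧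
      1 / (4 * Real.log H) ≤ ∑ p ∈ primesP ε H, (1 : ℝ) / p := by
  have hε2 : 0 < ε ^ 2 := by positivity
  -- PNT: `|ϑ(x) - x| ≤ x/10` for large `x`
  have hpnt : ∀ᶠ x : ℝ in atTop, |Chebyshev.theta x - x| ≤ (1 / 10) * x := by
    have h := (Literature.NumberTheory.LFunctions.chebyshevTheta_isEquivalent.isLittleO.def (by norm_num : (0 : ℝ) < 1 / 10))
    filter_upwards [h, eventually_ge_atTop (0 : ℝ)] with x hx hx0
    simpa [Real.norm_eq_abs, abs_of_nonneg hx0] using hx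
  obtain ⟨x₀, hx₀⟩ := Filter.eventually_atTop.mp hpnt
  -- largeness conditions on `H`: `ε² H / 2 ≥ max x₀ 1` and `H ≥ 2`
  have c1 : ∀ᶠ H : ℕ in atTop, 2 * max x₀ 1 ≤ ε ^ 2 * H :=
    (tendsto_natCast_atTop_atTop.const_mul_atTop hε2).eventually_ge_atTop _
  have c2 : ∀ᶠ H : ℕ in atTop, (2 : ℝ) ≤ H := tendsto_natCast_atTop_atTop.eventually_ge_atTop 2
  filter_upwards [c1, c2] with H hH hH2
  set y : ℝ := ε ^ 2 * H with hy
  have hmax : x₀ ≤ max x₀ 1 := le_max_left _ _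
  have hmax1 : (1 : ℝ) ≤ max x₀ 1 := le_max_right _ _
  have hy2 : 2 ≤ y := by linarith
  have hyH : y ≤ H := by rw [hy]; nlinarith [pow_le_one₀ hε.le hε1 (n := 2)]
  have hlogy : 0 < Real.log y := Real.log_pos (by linarith)
  have hlogH : Real.log y ≤ Real.log H := Real.log_le_log (by linarith) hyH
  have hlogH0 : 0 < Real.log H := lt_of_lt_of_le hlogy hlogH
  -- `ϑ(y) - ϑ(y/2) ≥ 0.9 y - 1.1 (y/2) = 0.35 y`
  have h1 := hx₀ y (by linarith)
  have h2 := hx₀ (y / 2) (by linarith)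
  rw [abs_le] at h1 h2
  have hθ : (7 / 20) * y ≤ Chebyshev.theta y - Chebyshev.theta (y / 2) := by linarith
  have hcard := theta_sub_theta_half_le (ε := ε) (H := H) (by linarith)
  rw [← hy] at hcard
  -- `#𝒫 ≥ 0.35 y / log y ≥ y / (4 log H)`
  have hcard' : (7 / 20) * y / Real.log H ≤ (primesP ε H).card := by
    rw [div_le_iff₀ hlogH0]
    calc (7 / 20) * y ≤ (primesP ε H).card * Real.log y := hθ.trans hcard
      _ ≤ (primesP ε H).card * Real.log H :=
          mul_le_mul_of_nonneg_left hlogH (Nat.cast_nonneg _)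
  refine ⟨?_, ?_⟩
  · calc ε ^ 2 * H / (4 * Real.log H) = (1 / 4) * y / Real.log H := by rw [hy]; ring
      _ ≤ (7 / 20) * y / Real.log H := by
          apply div_le_div_of_nonneg_right _ hlogH0.le
          nlinarith
      _ ≤ _ := hcard'
  · -- `∑ 1/p ≥ #𝒫 / y`
    have hsum : ((primesP ε H).card : ℝ) / y ≤ ∑ p ∈ primesP ε H, (1 : ℝ) / p := by
      rw [div_eq_mul_one_div, ← nsmul_eq_mul, ← sum_const]
      refine sum_le_sum fun p hp => ?_
      have hpy := (mem_primesP.1 hp).2.2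
      have hp0 : (0 : ℝ) < p := by exact_mod_cast (prime_of_mem_primesP hp).pos
      exact one_div_le_one_div_of_le hp0 (by rwa [← hy] at hpy)
    refine le_trans ?_ hsum
    rw [le_div_iff₀ (by linarith)]
    calc 1 / (4 * Real.log H) * y = (1 / 4) * y / Real.log H := by ring
      _ ≤ (7 / 20) * y / Real.log H := by
          apply div_le_div_of_nonneg_right _ hlogH0.le
          nlinarith
      _ ≤ _ := hcard'

end Tao2016

end Literature.NumberTheory.LFunctions
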